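import Summits.AnomalousDissipation.AnomalousDissipation.Theorems.SolenoidalFractalHomogenisationLagrangianStepSidebandResponseFrame
import Summits.AnomalousDissipation.AnomalousDissipation.Theorems.SolenoidalFractalHomogenisationLagrangianStepSidebandResponseUnique
import HarnessLib

/-!
# K1L_D `LagrangianRenormalisationStepDesign` (stmt-AnomalousDissipation-27980), registered stub `stub_D1_V0thg` (v28, rulings D28-3 (3)/D28-6/D28-7), port-map layer L4:
# the TWISTED periodic linear response is UNIQUE and BOUNDED, so `Sideband.responseθ` is characterised by its equation
# (helper; `--kind proof --supports stmt-AnomalousDissipation-27980 --as helper`)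

Summits-side helper file of route `SolenoidalFractalHomogenisation` (prover seat `ad-k1l-cellLawV-w1` g9; road of record D28-7 = port map §3 L4).  Everything proved; no
definitions, no named facts, no sorry.  The frozen-frame twin of `…SidebandResponseUnique` (brick T2, uniqueness and bounds); `slotEnvelope_mem_Icc`,
`sum_ite_coe_eq_le_one` of the flat file are REUSED BY NAME.  Every rate `min(γ₁, 4π²lo')` becomes `min(γ₁, 4π²lo'c)` for a frame with `c|k|² ≤ |G₀ᵀk|²` (`c > 0`).
* `norm_sourceCompθ_le`, `norm_sourceθ_le` (`‖sourceθ‖ ≤ 4π‖αⱼ‖`, since `‖P^θ‖ ≤ 1`);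
* `exists_isPeriodicResponseθ_norm_le` (bound `8π‖αⱼ‖/min(γ₁, 4π²lo'c)` on `[0,P]`);
* **`isPeriodicResponseθ_unique`**, `eq_responseθ_of_isPeriodicResponseθ`, `norm_responseθ_le`, `meanFeedbackθ_eq_of_isPeriodicResponseθ`.
NOT a proof of `stub_D1_V0thg`, of K1L_D, or of anomalous dissipation; rung F-D1.A0 infrastructure.
-/

set_option linter.dupNamespace false

noncomputable section

namespace Summit.AnomalousDissipation.AnomalousDissipation.Theorems.SolenoidalFractalHomogenisation.LagrangianStep.Sideband

open Set MeasureTheory Complex UnitAddTorus Filter Topology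
open scoped InnerProductSpace
open Literature.Analysis Literature.Analysis.FunctionSpaces Literature.Analysis.FunctionSpaces.Torus
open Literature.Analysis.FluidPDE Literature.Analysis.FluidPDE.Torus Literature.Analysis.FluidPDE.LatticeShear
open Summit.AnomalousDissipation.AnomalousDissipation.Theorems.SolenoidalFractalHomogenisation.PermissibleCarrier (period_pos trapezoid_nonneg trapezoid_le_one)

variable {k₀ : ℕ}

/-! ## §1 The size of the twisted unit source -/

/-- A component of the unit source is at most `2π‖αⱼ‖` times the indicator of `z = ±mⱼ`. [cite: MajdaKramer1999, §2.2.1.3] -/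
theorem norm_sourceCompθ_le (W₁ : LatticeWord k₀) (G₀ : Matrix (Fin 3) (Fin 3) ℝ) (R : ℕ) (j : Fin k₀) (t : ℝ) (z : box R) (v : EuclideanSpace ℂ (Fin 3)) :
    ‖sourceCompθ W₁ G₀ R j t z v‖ ≤
      ((if (z : Fin 3 → ℤ) = (W₁.phase j).m then 1 else 0) + (if (z : Fin 3 → ℤ) = -(W₁.phase j).m then 1 else 0)) *
        (2 * Real.pi * ‖slotAmp W₁ j‖ * ‖v‖) := by
  have henv := slotEnvelope_mem_Icc W₁ j t
  have hc : ∀ a : ℂ, ‖a‖ = ‖slotAmp W₁ j‖ →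
      ‖(-(2 * Real.pi * Complex.I * ((slotEnvelope W₁ j t : ℝ) : ℂ) * a)) • transversalProjR (twistFreq G₀ z.1) v‖ ≤ 2 * Real.pi * ‖slotAmp W₁ j‖ * ‖v‖ := by
    intro a ha
    have hn : ‖(-(2 * Real.pi * Complex.I * ((slotEnvelope W₁ j t : ℝ) : ℂ) * a))‖ = 2 * Real.pi * slotEnvelope W₁ j t * ‖slotAmp W₁ j‖ := by
      rw [norm_neg]
      simp [abs_of_pos Real.pi_pos, abs_of_nonneg henv.1, ha]
    rw [norm_smul, hn]
    have hP := norm_transversalProjR_le (twistFreq G₀ z.1) v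
    have h3 : 2 * Real.pi * slotEnvelope W₁ j t * ‖slotAmp W₁ j‖ ≤ 2 * Real.pi * 1 * ‖slotAmp W₁ j‖ := by
      gcongr; exact henv.2
    calc 2 * Real.pi * slotEnvelope W₁ j t * ‖slotAmp W₁ j‖ * ‖transversalProjR (twistFreq G₀ z.1) v‖
        ≤ 2 * Real.pi * 1 * ‖slotAmp W₁ j‖ * ‖v‖ := mul_le_mul h3 hP (norm_nonneg _) (by positivity)
      _ = 2 * Real.pi * ‖slotAmp W₁ j‖ * ‖v‖ := by ring
  rw [sourceCompθ, add_apply]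
  refine (norm_add_le _ _).trans ?_
  rw [add_mul]
  refine add_le_add ?_ ?_
  · split_ifs with h
    · rw [smul_apply, one_mul]; exact hc _ rfl
    · simp
  · split_ifs with h
    · rw [smul_apply, one_mul]; exact hc _ (by rw [RCLike.norm_conj])
    · simp

/-- **The unit source is bounded**: `‖sourceθ W₁ G₀ R j t‖ ≤ 4π‖αⱼ‖`. [cite: MajdaKramer1999, §2.2.1.3] -/
theorem norm_sourceθ_le (W₁ : LatticeWord k₀) (G₀ : Matrix (Fin 3) (Fin 3) ℝ) (R : ℕ) (j : Fin k₀) (t : ℝ) : ‖sourceθ W₁ G₀ R j t‖ ≤ 4 * Real.pi * ‖slotAmp W₁ j‖ := by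
  classical
  refine ContinuousLinearMap.opNorm_le_bound _ (by positivity) fun v => ?_
  set a : ℝ := 2 * Real.pi * ‖slotAmp W₁ j‖ * ‖v‖ with ha
  have ha0 : 0 ≤ a := by positivity
  -- the square of the norm is the sum of the squared components
  have hsq : ‖sourceθ W₁ G₀ R j t v‖ ^ 2 = ∑ z : box R, ‖sourceCompθ W₁ G₀ R j t z v‖ ^ 2 := by
    rw [PiLp.norm_sq_eq_of_L2]
    exact Finset.sum_congr rfl fun z _ => by rw [sourceθ_apply]
  have hcomp : ∀ z : box R, ‖sourceCompθ W₁ G₀ R j t z v‖ ^ 2 ≤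
      2 * ((if (z : Fin 3 → ℤ) = (W₁.phase j).m then 1 else 0) + (if (z : Fin 3 → ℤ) = -(W₁.phase j).m then 1 else 0)) * a ^ 2 := by
    intro z
    have h := norm_sourceCompθ_le W₁ G₀ R j t z v
    rw [← ha] at h
    have hs : ((if (z : Fin 3 → ℤ) = (W₁.phase j).m then (1:ℝ) else 0) + (if (z : Fin 3 → ℤ) = -(W₁.phase j).m then 1 else 0)) ^ 2 ≤
        2 * ((if (z : Fin 3 → ℤ) = (W₁.phase j).m then (1:ℝ) else 0) + (if (z : Fin 3 → ℤ) = -(W₁.phase j).m then 1 else 0)) := by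
      split_ifs <;> norm_num
    calc ‖sourceCompθ W₁ G₀ R j t z v‖ ^ 2
        ≤ (((if (z : Fin 3 → ℤ) = (W₁.phase j).m then (1:ℝ) else 0) + (if (z : Fin 3 → ℤ) = -(W₁.phase j).m then 1 else 0)) * a) ^ 2 :=
          pow_le_pow_left₀ (norm_nonneg _) h 2
      _ = ((if (z : Fin 3 → ℤ) = (W₁.phase j).m then (1:ℝ) else 0) + (if (z : Fin 3 → ℤ) = -(W₁.phase j).m then 1 else 0)) ^ 2 * a ^ 2 := by ring
      _ ≤ _ := mul_le_mul_of_nonneg_right hs (sq_nonneg a)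
  have hsum : ‖sourceθ W₁ G₀ R j t v‖ ^ 2 ≤ 4 * a ^ 2 := by
    rw [hsq]
    refine (Finset.sum_le_sum fun z _ => hcomp z).trans ?_
    rw [← Finset.sum_mul, ← Finset.mul_sum, Finset.sum_add_distrib]
    have h1 := sum_ite_coe_eq_le_one R (W₁.phase j).m
    have h2 := sum_ite_coe_eq_le_one R (-(W₁.phase j).m)
    nlinarith [sq_nonneg a]
  have h4 : ‖sourceθ W₁ G₀ R j t v‖ ≤ 2 * a := by
    have h0 : 0 ≤ 2 * a := by positivity
    nlinarith [norm_nonneg (sourceθ W₁ G₀ R j t v), hsum]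
  calc ‖sourceθ W₁ G₀ R j t v‖ ≤ 2 * a := h4
    _ = 4 * Real.pi * ‖slotAmp W₁ j‖ * ‖v‖ := by rw [ha]; ring

/-! ## §2 Existence with the explicit bound -/

/-- **A periodic response with the bound `‖N t‖ ≤ 8π‖αⱼ‖/min(γ₁, 4π²lo')` on `[0,P]`.** [cite: SandersVerhulstMurdock2007, Lemma 5.2.7 (linear case)] -/
theorem exists_isPeriodicResponseθ_norm_le (W₁ : LatticeWord k₀) {𝔸 : Torus.Visc4 (Fin 3)} {lo' hi' : ℝ} (h𝔸 : Torus.NearIso 𝔸 lo' hi')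
    (hlo' : 0 < lo') (G₀ : Matrix (Fin 3) (Fin 3) ℝ) {c : ℝ} (hc : 0 < c) (hG : ∀ k : Fin 3 → ℤ, c * freqNormSq k ≤ ∑ a, twistFreq G₀ k a ^ 2)
    {γ₁ : ℝ} (hγ₁ : 0 < γ₁) (R : ℕ) (j : Fin k₀) :
    ∃ N, IsPeriodicResponseθ W₁ 𝔸 G₀ γ₁ R j N ∧ ∀ t ∈ Icc 0 W₁.period, ‖N t‖ ≤ 8 * Real.pi * ‖slotAmp W₁ j‖ / min γ₁ (4 * Real.pi ^ 2 * (lo' * c)) := by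
  have hP : 0 < W₁.period := period_pos W₁
  set γ : ℝ := min γ₁ (4 * Real.pi ^ 2 * (lo' * c)) with hγdef
  have hγ : 0 < γ := lt_min hγ₁ (by positivity)
  set δ₁ : ℝ := 4 * Real.pi * ‖slotAmp W₁ j‖ with hδ₁def
  have hδ₁ : 0 ≤ δ₁ := by positivity
  set ε : ℝ := γ / (4 * (δ₁ + 1)) with hεdef
  have hε : 0 < ε := by positivity
  set δ : ℝ := ε * δ₁ with hδdef
  have hδ : 0 ≤ δ := by positivity
  have hδγ : δ ≤ γ / 4 := by
    rw [hδdef, hεdef, div_mul_eq_mul_div, div_le_div_iff₀ (by positivity) (by norm_num)]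
    nlinarith [hγ.le, hδ₁]
  have h8 : 8 * δ ^ 2 ≤ γ ^ 2 := by nlinarith [hδγ, hδ, hγ.le]
  obtain ⟨Nε, hcN, hd, hb, hp⟩ := SlowGraph.linearGraph_periodic_on (EuclideanSpace ℂ (Fin 3)) (Space R)
    (fun t => ε • (sourceθ W₁ G₀ R j t).restrictScalars ℝ) (fun t => (genθ W₁ 𝔸 G₀ γ₁ R t).restrictScalars ℝ) γ δ W₁.period W₁.period hδ hγ h8 hP le_rfl
    (fun t _ z => by
      rw [ContinuousLinearMap.coe_restrictScalars']
      exact real_inner_genθ_le W₁ h𝔸 hlo'.le G₀ hc.le hG γ₁ R t z)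
    (fun t _ => by
      rw [norm_smul, Real.norm_of_nonneg hε.le, ContinuousLinearMap.norm_restrictScalars]
      exact mul_le_mul_of_nonneg_left (norm_sourceθ_le W₁ G₀ R j t) hε.le)
    (by
      rw [continuousOn_clm_apply]
      intro v
      have h := ((continuous_clm_apply.1 (continuous_sourceθ W₁ G₀ R j)) v).const_smul ε
      exact h.continuousOn.congr fun t _ => by simp)
    (by
      rw [continuousOn_clm_apply]
      intro v
      have h := (continuous_clm_apply.1 (continuous_genθ W₁ 𝔸 G₀ γ₁ R)) v
      exact h.continuousOn.congr fun t _ => by simp)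
    (fun t _ _ => by rw [sourceθ_add_period])
    (fun t _ _ => by rw [genθ_add_period])
  have hper : Nε W₁.period = Nε 0 := by
    have h := hp 0 le_rfl (by rw [zero_add])
    rwa [zero_add] at h
  refine ⟨fun t => ε⁻¹ • Nε t, ⟨hcN.const_smul ε⁻¹, fun t ht => ?_, by simp only [hper]⟩, fun t ht => ?_⟩
  · have h := (hd t ht).const_smul ε⁻¹
    refine h.congr_deriv ?_
    rw [smul_add, smul_smul, inv_mul_cancel₀ hε.ne', one_smul, ContinuousLinearMap.comp_smul]
  · rw [norm_smul, norm_inv, Real.norm_of_nonneg hε.le]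
    have h1 := hb t ht
    calc ε⁻¹ * ‖Nε t‖ ≤ ε⁻¹ * (2 * δ / γ) := mul_le_mul_of_nonneg_left h1 (by positivity)
      _ = 2 * δ₁ / γ := by rw [hδdef]; field_simp
      _ = 8 * Real.pi * ‖slotAmp W₁ j‖ / γ := by rw [hδ₁def]; ring

/-! ## §3 Uniqueness of the periodic response -/

/-- **UNIQUENESS**: for `NearIso 𝔸 lo' hi'` with `lo' > 0` and `γ₁ > 0`, two periodic responses of the same slot coincide on `[0,P]`.
[cite: SandersVerhulstMurdock2007, Lemma 5.2.7 (linear case)] -/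
theorem isPeriodicResponseθ_unique (W₁ : LatticeWord k₀) {𝔸 : Torus.Visc4 (Fin 3)} {lo' hi' : ℝ} (h𝔸 : Torus.NearIso 𝔸 lo' hi') (hlo' : 0 < lo')
    (G₀ : Matrix (Fin 3) (Fin 3) ℝ) {c : ℝ} (hc : 0 < c) (hG : ∀ k : Fin 3 → ℤ, c * freqNormSq k ≤ ∑ a, twistFreq G₀ k a ^ 2)
    {γ₁ : ℝ} (hγ₁ : 0 < γ₁) {R : ℕ} {j : Fin k₀} {N₁ N₂ : ℝ → (EuclideanSpace ℂ (Fin 3) →L[ℝ] Space R)}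
    (h₁ : IsPeriodicResponseθ W₁ 𝔸 G₀ γ₁ R j N₁) (h₂ : IsPeriodicResponseθ W₁ 𝔸 G₀ γ₁ R j N₂) :
    ∀ t ∈ Icc 0 W₁.period, N₁ t = N₂ t := by
  have hP : 0 < W₁.period := period_pos W₁
  set γ : ℝ := min γ₁ (4 * Real.pi ^ 2 * (lo' * c)) with hγdef
  have hγ : 0 < γ := lt_min hγ₁ (by positivity)
  obtain ⟨hc₁, hd₁, hp₁⟩ := h₁
  obtain ⟨hc₂, hd₂, hp₂⟩ := h₂
  -- the difference solves the homogeneous equation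
  have hD : ∀ t ∈ Ico 0 W₁.period, HasDerivAt (fun s => N₁ s - N₂ s)
      (((genθ W₁ 𝔸 G₀ γ₁ R t).restrictScalars ℝ).comp (N₁ t - N₂ t)) t := by
    intro t ht
    have h := (hd₁ t ht).sub (hd₂ t ht)
    refine h.congr_deriv ?_
    rw [ContinuousLinearMap.comp_sub]; abel
  -- fix a test vector
  suffices hv : ∀ v : EuclideanSpace ℂ (Fin 3), ∀ t ∈ Icc 0 W₁.period, (N₁ t - N₂ t) v = 0 by
    intro t ht
    have := fun v => hv v t ht
    exact sub_eq_zero.1 (ContinuousLinearMap.ext this)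
  intro v
  set φ : ℝ → ℝ := fun s => ‖(N₁ s - N₂ s) v‖ ^ 2 with hφ
  set ψ : ℝ → ℝ := fun s => Real.exp (2 * γ * s) * φ s with hψ
  -- derivative of `φ` and the dissipation bound
  have hφd : ∀ t ∈ Ico 0 W₁.period, HasDerivAt φ
      (2 * ⟪(N₁ t - N₂ t) v, (((genθ W₁ 𝔸 G₀ γ₁ R t).restrictScalars ℝ).comp (N₁ t - N₂ t)) v + (N₁ t - N₂ t) 0⟫_ℝ) t :=
    fun t ht => ((hD t ht).clm_apply (hasDerivAt_const t v)).norm_sq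
  have hφb : ∀ t ∈ Ico 0 W₁.period,
      2 * ⟪(N₁ t - N₂ t) v, (((genθ W₁ 𝔸 G₀ γ₁ R t).restrictScalars ℝ).comp (N₁ t - N₂ t)) v + (N₁ t - N₂ t) 0⟫_ℝ ≤ -(2 * γ) * φ t := by
    intro t ht
    rw [map_zero, add_zero, ContinuousLinearMap.comp_apply, real_inner_comm, ContinuousLinearMap.coe_restrictScalars']
    have h := real_inner_genθ_le W₁ h𝔸 hlo'.le G₀ hc.le hG γ₁ R t ((N₁ t - N₂ t) v)
    have hφt : φ t = ‖(N₁ t - N₂ t) v‖ ^ 2 := rfl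
    rw [hφt]
    linarith
  -- `ψ` is continuous on `[0,P]` and non-increasing
  have hφc : ContinuousOn φ (Icc 0 W₁.period) := by
    have h1 : ContinuousOn (fun s => (N₁ s - N₂ s) v) (Icc 0 W₁.period) := (hc₁.sub hc₂).clm_apply continuousOn_const
    exact (h1.norm).pow 2
  have hψc : ContinuousOn ψ (Icc 0 W₁.period) := (Real.continuous_exp.comp (continuous_const.mul continuous_id)).continuousOn.mul hφc
  have hψd : ∀ t ∈ Ico 0 W₁.period, HasDerivAt ψ (Real.exp (2 * γ * t) * (2 * γ) * φ t +
      Real.exp (2 * γ * t) * (2 * ⟪(N₁ t - N₂ t) v, (((genθ W₁ 𝔸 G₀ γ₁ R t).restrictScalars ℝ).comp (N₁ t - N₂ t)) v + (N₁ t - N₂ t) 0⟫_ℝ)) t := by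
    intro t ht
    have he : HasDerivAt (fun s => Real.exp (2 * γ * s)) (Real.exp (2 * γ * t) * (2 * γ)) t := by
      have := ((hasDerivAt_id t).const_mul (2 * γ)).exp
      simpa using this
    exact he.mul (hφd t ht)
  have hanti : AntitoneOn ψ (Icc 0 W₁.period) := by
    refine antitoneOn_of_deriv_nonpos (convex_Icc 0 W₁.period) hψc ?_ ?_
    · rw [interior_Icc]
      intro t ht
      exact (hψd t ⟨ht.1.le, ht.2⟩).differentiableAt.differentiableWithinAt
    · rw [interior_Icc]
      intro t ht
      rw [(hψd t ⟨ht.1.le, ht.2⟩).deriv]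
      have h := hφb t ⟨ht.1.le, ht.2⟩
      have hpos : 0 < Real.exp (2 * γ * t) := Real.exp_pos _
      nlinarith
  -- periodicity forces `φ 0 = 0`
  have hφP : φ W₁.period = φ 0 := by simp only [hφ, hp₁, hp₂]
  have hφ0 : φ 0 = 0 := by
    have h1 : ψ W₁.period ≤ ψ 0 := hanti ⟨le_rfl, hP.le⟩ ⟨hP.le, le_rfl⟩ hP.le
    simp only [hψ, mul_zero, Real.exp_zero, one_mul, hφP] at h1
    have hgt : 1 < Real.exp (2 * γ * W₁.period) := Real.one_lt_exp_iff.2 (by positivity)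
    have hnn : 0 ≤ φ 0 := sq_nonneg _
    nlinarith
  -- hence `φ ≡ 0` on `[0,P]`
  intro t ht
  have h1 : ψ t ≤ ψ 0 := hanti ⟨le_rfl, hP.le⟩ ht ht.1
  simp only [hψ, mul_zero, Real.exp_zero, hφ0] at h1
  have hpos : 0 < Real.exp (2 * γ * t) := Real.exp_pos _
  have hφt : φ t = 0 := le_antisymm (by nlinarith [sq_nonneg ‖(N₁ t - N₂ t) v‖]) (sq_nonneg _)
  simpa [hφ] using hφt

/-! ## §4 Characterisation and bounds of `Sideband.response` -/

/-- **Any periodic response IS `Sideband.response`** on `[0,P]`. [cite: SandersVerhulstMurdock2007, Lemma 5.2.7 (linear case)] -/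
theorem eq_responseθ_of_isPeriodicResponseθ (W₁ : LatticeWord k₀) {𝔸 : Torus.Visc4 (Fin 3)} {lo' hi' : ℝ} (h𝔸 : Torus.NearIso 𝔸 lo' hi')
    (hlo' : 0 < lo') (G₀ : Matrix (Fin 3) (Fin 3) ℝ) {c : ℝ} (hc : 0 < c) (hG : ∀ k : Fin 3 → ℤ, c * freqNormSq k ≤ ∑ a, twistFreq G₀ k a ^ 2)
    {γ₁ : ℝ} (hγ₁ : 0 < γ₁) {R : ℕ} {j : Fin k₀} {N : ℝ → (EuclideanSpace ℂ (Fin 3) →L[ℝ] Space R)}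
    (hN : IsPeriodicResponseθ W₁ 𝔸 G₀ γ₁ R j N) : ∀ t ∈ Icc 0 W₁.period, N t = responseθ W₁ 𝔸 G₀ γ₁ R j t :=
  isPeriodicResponseθ_unique W₁ h𝔸 hlo' G₀ hc hG hγ₁ hN (isPeriodicResponseθ_responseθ ⟨N, hN⟩)

/-- **The response is bounded**: `‖response t‖ ≤ 8π‖αⱼ‖/min(γ₁, 4π²lo')` on `[0,P]`. [cite: SandersVerhulstMurdock2007, Lemma 5.2.7 (linear case)] -/
theorem norm_responseθ_le (W₁ : LatticeWord k₀) {𝔸 : Torus.Visc4 (Fin 3)} {lo' hi' : ℝ} (h𝔸 : Torus.NearIso 𝔸 lo' hi') (hlo' : 0 < lo')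
    (G₀ : Matrix (Fin 3) (Fin 3) ℝ) {c : ℝ} (hc : 0 < c) (hG : ∀ k : Fin 3 → ℤ, c * freqNormSq k ≤ ∑ a, twistFreq G₀ k a ^ 2)
    {γ₁ : ℝ} (hγ₁ : 0 < γ₁) (R : ℕ) (j : Fin k₀) {t : ℝ} (ht : t ∈ Icc 0 W₁.period) :
    ‖responseθ W₁ 𝔸 G₀ γ₁ R j t‖ ≤ 8 * Real.pi * ‖slotAmp W₁ j‖ / min γ₁ (4 * Real.pi ^ 2 * (lo' * c)) := by
  obtain ⟨N, hN, hb⟩ := exists_isPeriodicResponseθ_norm_le W₁ h𝔸 hlo' G₀ hc hG hγ₁ R j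
  rw [← eq_responseθ_of_isPeriodicResponseθ W₁ h𝔸 hlo' G₀ hc hG hγ₁ hN t ht]
  exact hb t ht

/-- **The feedback matrix may be computed from ANY periodic response.** [cite: MajdaKramer1999, §2.2.1.3 (55)] -/
theorem meanFeedbackθ_eq_of_isPeriodicResponseθ (W₁ : LatticeWord k₀) {𝔸 : Torus.Visc4 (Fin 3)} {lo' hi' : ℝ} (h𝔸 : Torus.NearIso 𝔸 lo' hi')
    (hlo' : 0 < lo') (G₀ : Matrix (Fin 3) (Fin 3) ℝ) {c : ℝ} (hc : 0 < c) (hG : ∀ k : Fin 3 → ℤ, c * freqNormSq k ≤ ∑ a, twistFreq G₀ k a ^ 2)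
    {γ₁ : ℝ} (hγ₁ : 0 < γ₁) {R : ℕ} (j : Fin k₀) {j' : Fin k₀} {N : ℝ → (EuclideanSpace ℂ (Fin 3) →L[ℝ] Space R)}
    (hN : IsPeriodicResponseθ W₁ 𝔸 G₀ γ₁ R j' N) :
    meanFeedbackθ W₁ 𝔸 G₀ γ₁ R j j' = (1 / W₁.period) • ∫ t in (0:ℝ)..W₁.period, ((feedback W₁ R j t).restrictScalars ℝ).comp (N t) := by
  have hint : ∫ t in (0:ℝ)..W₁.period, ((feedback W₁ R j t).restrictScalars ℝ).comp (responseθ W₁ 𝔸 G₀ γ₁ R j' t) =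
      ∫ t in (0:ℝ)..W₁.period, ((feedback W₁ R j t).restrictScalars ℝ).comp (N t) := by
    refine intervalIntegral.integral_congr fun t ht => ?_
    rw [uIcc_of_le (period_pos W₁).le] at ht
    simp only [eq_responseθ_of_isPeriodicResponseθ W₁ h𝔸 hlo' G₀ hc hG hγ₁ hN t ht]
  rw [meanFeedbackθ, hint]

end Summit.AnomalousDissipation.AnomalousDissipation.Theorems.SolenoidalFractalHomogenisation.LagrangianStep.Sideband

end
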